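import Mathlib
import HarnessLib
import Summits.HubbardSuperconductivity.HubbardSuperconductivity.Theorems.KLProgrammeC4aPPKernelTrueFlatness

/-!
# Route `KLProgramme` — crux C4a, S3 brick (B4) «(B4)-UMK1», «(M1)-TRUE-KERNEL» analytic half, part 3: the flatness number of the true pp pair kernel IN (N2)'s SHAPE
# `A_fl(D) ≤ A₁·Λ/max(D, Λ)²` FOR EVERY anti-diagonal level `D > 0` (short lines by a uniform gradient bound, long lines by `…TrueFlatness`)

Cell `gate-hubbard-kl`, seat hubbard-kl-k3c3-p1 (g15; row «δμ-flow with klAngularMean constant piece»).  Continuation of `…C4aPPKernelTrueFlatness` (stub (C) of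
stmt-HubbardSuperconductivity-20437; (U1) chain of hubbard-kl-k3c3-p3, whose loop-angle layer `…C4aPreCausticAngleLayer.intervalIntegral_pre_caustic_angle_le` consumes the
per-line law in the shape `A₁·lo/(max (D v) lo)²` for every line, including the short ones `D ≤ lo`).
* §1 **`abs_ppTrueNumeratorDu_le_unif`** — the UNIFORM, temperature-free gradient bound `|∂ᵤN(e,u)| ≤ (6B₁ + 5/2)/Λ` for ALL levels (the cutoff derivative carries the
  factor `2u/Λ²`, so `|W′(ω,u)·u/(ω²+u²)| ≤ 4B₁/(ω²+Λ²)` without any `1/ω`; `|W(ω,e)·e/(ω²+e²)| ≤ 2/Λ`; `|W·∂L| ≤ 5/(ω²+Λ²)`); by symmetry the same for `∂ₑN`;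
* §2 `ppTrueNumerator_zero_zero` (`N(0,0) = 0`) and **`abs_ppTrueNumerator_le_sum`** (`|N(e,u)| ≤ (6B₁+5/2)/Λ·(e+u)` on the quadrant, two mean-value steps);
* §3 **`trueKernel_antidiagonal_flatness_short_le`** — for EVERY `D > 0`: `|∫_0^D ∂ᵤK(e,D−e) de| ≤ (6B₁+5/2)(2κ₀+κ₁)/Λ` (`|κ′| ≤ κ₁` on `[0,1]`);
* §4 **`trueKernel_antidiagonal_flatness_shape`** — for every `D > 0`:
  `|∫_0^D ∂ᵤK(e,D−e) de| ≤ A₁·Λ/max(D,Λ)²`,  `A₁ = (6B₁+5/2)(2κ₀+κ₁)·4/(1−t₁)² + κ₀(10B₁ + 7/2 + 2/(βΛ) + 1/(1−t₁))`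
  (short lines `D ≤ 2Λ/(1−t₁)` by §3, long lines by `trueKernel_antidiagonal_flatness_le`) — literally the `A₁·lo/(max D lo)²` of the angle layer with `lo = Λ`; `2/(βΛ) ≤ 2/π`
  in the KL regime, so `A₁` is n-free.
Pure real analysis; nothing asserts (C), K3 or superconductivity.
References: BGM 2006 §2.1, §2.4 [cite: BenfattoGiulianiMastropietro2006]; FST II CPAM 51 (1998) §3 [cite: FeldmanSalmhoferTrubowitz1998]; Salmhofer 1999 §4.5.3
[cite: Salmhofer1999].
-/

noncomputable section

namespace Summit.HubbardSuperconductivity.HubbardSuperconductivity.Theorems.C4a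

set_option linter.dupNamespace false -- summit = problem name (single-conjunct summit), D-0017

open Real Filter Set MeasureTheory intervalIntegral
open scoped Topology Interval
open Literature.MathematicalPhysics.QuantumLattice Literature.Analysis.SpecialFunctions

/-! ## §1 The uniform gradient bound -/

/-- **The cutoff derivative times its OWN Lorentzian carries no `1/ω`**: `|W′(ω,u)·u/(ω²+u²)| ≤ 4B₁/(ω² + Λ²)` (`Λ > 0`): `W′(ω,u) = χ′((u²+ω²)/Λ²)·2u/Λ²`, so the
product is `χ′·2u²/(Λ²(ω²+u²))`, bounded by `2B₁/Λ²` and supported on the shell `ω² ≤ Λ²`. [cite: Salmhofer1999, §4.2.5 (4.71)] -/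
theorem abs_uvWeightFnD1_mul_lorentzian_self_le {B₁ : ℝ} (hB₁ : ∀ x, |deriv salmhoferCutoff x| ≤ B₁) {Λ : ℝ} (hΛ : 0 < Λ) (ω u : ℝ) :
    |uvWeightFnD1 Λ ω u * (u / (ω ^ 2 + u ^ 2))| ≤ 4 * B₁ / (ω ^ 2 + Λ ^ 2) := by
  have hB0 := salmhoferB₁_nonneg hB₁
  by_cases h : Λ ^ 2 < u ^ 2 + ω ^ 2
  · rw [(uvWeightFn_eq_one_of_gt hΛ h).2.1, zero_mul, abs_zero]; positivity
  · have hω : ω ^ 2 ≤ Λ ^ 2 := by nlinarith [not_lt.1 h, sq_nonneg u]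
    by_cases hs : ω ^ 2 + u ^ 2 = 0
    · rw [hs, div_zero, mul_zero, abs_zero]; positivity
    have hspos : 0 < ω ^ 2 + u ^ 2 := lt_of_le_of_ne (by positivity) (Ne.symm hs)
    have hform : uvWeightFnD1 Λ ω u * (u / (ω ^ 2 + u ^ 2)) =
        deriv salmhoferCutoff ((u ^ 2 + ω ^ 2) / Λ ^ 2) * (2 / Λ ^ 2 * (u ^ 2 / (ω ^ 2 + u ^ 2))) := by
      unfold uvWeightFnD1; field_simp
    rw [hform, abs_mul]
    have h1 : |2 / Λ ^ 2 * (u ^ 2 / (ω ^ 2 + u ^ 2))| ≤ 2 / Λ ^ 2 := by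
      rw [abs_of_nonneg (by positivity)]
      have : u ^ 2 / (ω ^ 2 + u ^ 2) ≤ 1 := (div_le_one hspos).2 (by nlinarith [sq_nonneg ω])
      calc 2 / Λ ^ 2 * (u ^ 2 / (ω ^ 2 + u ^ 2)) ≤ 2 / Λ ^ 2 * 1 := mul_le_mul_of_nonneg_left this (by positivity)
        _ = 2 / Λ ^ 2 := mul_one _
    have h2 : 2 / Λ ^ 2 ≤ 4 / (ω ^ 2 + Λ ^ 2) := by
      rw [div_le_div_iff₀ (by positivity) (by positivity)]; nlinarith
    calc |deriv salmhoferCutoff ((u ^ 2 + ω ^ 2) / Λ ^ 2)| * |2 / Λ ^ 2 * (u ^ 2 / (ω ^ 2 + u ^ 2))| ≤ B₁ * (2 / Λ ^ 2) :=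
          mul_le_mul (hB₁ _) h1 (abs_nonneg _) hB0
      _ ≤ B₁ * (4 / (ω ^ 2 + Λ ^ 2)) := mul_le_mul_of_nonneg_left h2 hB0
      _ = 4 * B₁ / (ω ^ 2 + Λ ^ 2) := by ring

/-- **The weighted Lorentzian is bounded by the scale**: `|W(ω,e)·e/(ω²+e²)| ≤ 2/Λ` (`Λ > 0`): where `W ≠ 0`, `ω² + e² ≥ Λ²/4` and `|e|Λ ≤ e² + Λ²/4 ≤ 2(ω²+e²)`.
[cite: Salmhofer1999, §4.2.5 (4.71)] -/
theorem abs_uvWeightFn_mul_lorentzian_le {Λ : ℝ} (hΛ : 0 < Λ) (ω e : ℝ) : |uvWeightFn Λ ω e * (e / (ω ^ 2 + e ^ 2))| ≤ 2 / Λ := by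
  by_cases hW : uvWeightFn Λ ω e = 0
  · rw [hW, zero_mul, abs_zero]; positivity
  · have hs : Λ ^ 2 / 4 ≤ e ^ 2 + ω ^ 2 := sq_add_sq_ge_of_uvWeightFn_ne_zero hΛ hW
    have hpos : 0 < ω ^ 2 + e ^ 2 := by have := pow_pos hΛ 2; linarith
    rw [abs_mul, abs_div, abs_of_pos hpos]
    have h1 : |uvWeightFn Λ ω e| ≤ 1 := abs_uvWeightFn_le_one Λ ω e
    have h2 : |e| / (ω ^ 2 + e ^ 2) ≤ 2 / Λ := by
      rw [div_le_div_iff₀ hpos hΛ]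
      nlinarith [sq_nonneg (|e| - Λ / 2), sq_abs e, abs_nonneg e]
    calc |uvWeightFn Λ ω e| * (|e| / (ω ^ 2 + e ^ 2)) ≤ 1 * (2 / Λ) := mul_le_mul h1 h2 (by positivity) zero_le_one
      _ = 2 / Λ := one_mul _

/-- **THE UNIFORM GRADIENT BOUND**: `|∂ᵤN(e,u)| ≤ (6B₁ + 5/2)/Λ` for ALL levels `e, u` (temperature-free; per frequency
`|summand| ≤ (12B₁ + 5)/(ωₙ² + Λ²)`, summed by the tanh closed form). [cite: BenfattoGiulianiMastropietro2006, §2.4 (2.36)] -/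
theorem abs_ppTrueNumeratorDu_le_unif {β Λ : ℝ} (hβ : 0 < β) (hΛ : 0 < Λ) {B₁ : ℝ} (hB₁ : ∀ x, |deriv salmhoferCutoff x| ≤ B₁) (e u : ℝ) :
    |ppTrueNumeratorDu β Λ e u| ≤ (6 * B₁ + 5 / 2) / Λ := by
  have hB0 := salmhoferB₁_nonneg hB₁
  have hω : ∀ n : ℕ, 0 < ppFreq β n := ppFreq_pos hβ
  unfold ppTrueNumeratorDu
  set f : ℕ → ℝ := fun n => uvWeightFn Λ (ppFreq β n) e *
    (uvWeightFnD1 Λ (ppFreq β n) u * (e / (ppFreq β n ^ 2 + e ^ 2) + u / (ppFreq β n ^ 2 + u ^ 2)) +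
      uvWeightFn Λ (ppFreq β n) u * ((ppFreq β n ^ 2 - u ^ 2) / (ppFreq β n ^ 2 + u ^ 2) ^ 2)) with hf
  have hbd : ∀ n : ℕ, |f n| ≤ (12 * B₁ + 5) * (1 / (ppFreq β n ^ 2 + Λ ^ 2)) := fun n => by
    have h1 := abs_uvWeightFnD1_mul_lorentzian_self_le hB₁ hΛ (ppFreq β n) u
    have h2 := abs_uvWeightFn_mul_lorentzian_le hΛ (ppFreq β n) e
    have h3 := abs_uvWeightFnD1_le_shell hB₁ hΛ (ppFreq β n) u
    have h4 := abs_uvWeightFn_mul_lorentzian_deriv_le hΛ (hω n).ne' u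
    have hWe : |uvWeightFn Λ (ppFreq β n) e| ≤ 1 := abs_uvWeightFn_le_one _ _ _
    -- regroup: W_e·W′_u·L_u + (W_e·L_e)·W′_u + W_e·(W_u·L′_u)
    have hsplit : f n = uvWeightFn Λ (ppFreq β n) e * (uvWeightFnD1 Λ (ppFreq β n) u * (u / (ppFreq β n ^ 2 + u ^ 2))) +
        (uvWeightFn Λ (ppFreq β n) e * (e / (ppFreq β n ^ 2 + e ^ 2))) * uvWeightFnD1 Λ (ppFreq β n) u +
        uvWeightFn Λ (ppFreq β n) e * (uvWeightFn Λ (ppFreq β n) u * ((ppFreq β n ^ 2 - u ^ 2) / (ppFreq β n ^ 2 + u ^ 2) ^ 2)) := by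
      simp only [hf]; ring
    rw [hsplit]
    have hp1 : |uvWeightFn Λ (ppFreq β n) e * (uvWeightFnD1 Λ (ppFreq β n) u * (u / (ppFreq β n ^ 2 + u ^ 2)))| ≤ 1 * (4 * B₁ / (ppFreq β n ^ 2 + Λ ^ 2)) := by
      rw [abs_mul]; exact mul_le_mul hWe h1 (abs_nonneg _) zero_le_one
    have hp2 : |uvWeightFn Λ (ppFreq β n) e * (e / (ppFreq β n ^ 2 + e ^ 2)) * uvWeightFnD1 Λ (ppFreq β n) u| ≤
        2 / Λ * (2 * B₁ / Λ * (2 * Λ ^ 2 / (ppFreq β n ^ 2 + Λ ^ 2))) := by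
      rw [abs_mul]; exact mul_le_mul h2 h3 (abs_nonneg _) (by positivity)
    have hp3 : |uvWeightFn Λ (ppFreq β n) e * (uvWeightFn Λ (ppFreq β n) u * ((ppFreq β n ^ 2 - u ^ 2) / (ppFreq β n ^ 2 + u ^ 2) ^ 2))| ≤
        1 * (5 / (ppFreq β n ^ 2 + Λ ^ 2)) := by
      rw [abs_mul]; exact mul_le_mul hWe h4 (abs_nonneg _) zero_le_one
    refine (abs_add_three _ _ _).trans ((add_le_add (add_le_add hp1 hp2) hp3).trans (le_of_eq ?_))
    field_simp
    ring
  have hsb : Summable fun n : ℕ => (12 * B₁ + 5) * (1 / (ppFreq β n ^ 2 + Λ ^ 2)) := (summable_one_div_ppFreq_sq_add_sq hβ Λ).mul_left _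
  have hsf : Summable f := Summable.of_norm_bounded hsb fun n => by rw [Real.norm_eq_abs]; exact hbd n
  have htsum : |∑' n : ℕ, f n| ≤ (12 * B₁ + 5) * (β * Real.tanh (β * Λ / 2) / (4 * Λ)) := by
    rw [← tsum_one_div_ppFreq_sq_add_sq hβ hΛ.ne', ← tsum_mul_left]
    refine (norm_tsum_le_tsum_norm hsf.norm).trans ?_
    exact Summable.tsum_le_tsum (fun n => by rw [Real.norm_eq_abs]; exact hbd n) hsf.norm hsb
  have ht : Real.tanh (β * Λ / 2) ≤ 1 := (Real.tanh_lt_one _).le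
  have hβ2 : 0 < 2 / β := by positivity
  rw [abs_mul, abs_of_pos hβ2]
  calc 2 / β * |∑' n : ℕ, f n| ≤ 2 / β * ((12 * B₁ + 5) * (β * Real.tanh (β * Λ / 2) / (4 * Λ))) := mul_le_mul_of_nonneg_left htsum hβ2.le
    _ = (6 * B₁ + 5 / 2) / Λ * Real.tanh (β * Λ / 2) := by field_simp; ring
    _ ≤ (6 * B₁ + 5 / 2) / Λ * 1 := mul_le_mul_of_nonneg_left ht (by positivity)
    _ = (6 * B₁ + 5 / 2) / Λ := mul_one _

/-! ## §2 The numerator vanishes at the origin and is Lipschitz -/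

/-- `N(0,0) = 0` (both Lorentzians vanish at zero level). [folklore] -/
theorem ppTrueNumerator_zero_zero (β Λ : ℝ) : ppTrueNumerator β Λ 0 0 = 0 := by
  unfold ppTrueNumerator
  simp

/-- **`|N(e,u)| ≤ (6B₁ + 5/2)/Λ·(e + u)` for `e, u ≥ 0`** (two mean-value steps from `N(0,0) = 0` with the uniform gradient bound).
[cite: BenfattoGiulianiMastropietro2006, §2.4 (2.36)] -/
theorem abs_ppTrueNumerator_le_sum {β Λ : ℝ} (hβ : 0 < β) (hΛ : 0 < Λ) {B₁ : ℝ} (hB₁ : ∀ x, |deriv salmhoferCutoff x| ≤ B₁) {e u : ℝ} (he : 0 ≤ e) (hu : 0 ≤ u) :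
    |ppTrueNumerator β Λ e u| ≤ (6 * B₁ + 5 / 2) / Λ * (e + u) := by
  set S : ℝ := (6 * B₁ + 5 / 2) / Λ with hS
  -- step 1: in `u` at loop level `0`
  have h1 : ‖ppTrueNumerator β Λ 0 u - ppTrueNumerator β Λ 0 0‖ ≤ S * (u - 0) :=
    norm_image_sub_le_of_norm_deriv_le_segment' (f := fun v => ppTrueNumerator β Λ 0 v) (f' := fun v => ppTrueNumeratorDu β Λ 0 v)
      (fun v _ => (hasDerivAt_ppTrueNumerator_u hβ hΛ hB₁ 0 v).hasDerivWithinAt)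
      (fun v _ => by rw [Real.norm_eq_abs]; exact abs_ppTrueNumeratorDu_le_unif hβ hΛ hB₁ 0 v) u (right_mem_Icc.2 hu)
  -- step 2: in `e` at partner level `u`
  have h2 : ‖ppTrueNumerator β Λ e u - ppTrueNumerator β Λ 0 u‖ ≤ S * (e - 0) :=
    norm_image_sub_le_of_norm_deriv_le_segment' (f := fun x => ppTrueNumerator β Λ x u) (f' := fun x => ppTrueNumeratorDu β Λ u x)
      (fun x _ => (hasDerivAt_ppTrueNumerator_e hβ hΛ hB₁ x u).hasDerivWithinAt)
      (fun x _ => by rw [Real.norm_eq_abs]; exact abs_ppTrueNumeratorDu_le_unif hβ hΛ hB₁ u x) e (right_mem_Icc.2 he)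
  rw [ppTrueNumerator_zero_zero, sub_zero, Real.norm_eq_abs] at h1
  rw [Real.norm_eq_abs, sub_zero] at h2
  calc |ppTrueNumerator β Λ e u| = |(ppTrueNumerator β Λ e u - ppTrueNumerator β Λ 0 u) + ppTrueNumerator β Λ 0 u| := by rw [sub_add_cancel]
    _ ≤ |ppTrueNumerator β Λ e u - ppTrueNumerator β Λ 0 u| + |ppTrueNumerator β Λ 0 u| := abs_add_le _ _
    _ ≤ S * e + S * (u - 0) := add_le_add h2 h1
    _ = S * (e + u) := by ring

/-! ## §3 Short lines: every `D > 0` -/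

/-- **THE SHORT-LINE FLATNESS BOUND** (every `D > 0`): with `|κ| ≤ κ₀`, `|κ′| ≤ κ₁` on `[0,1]`,
`|∫_0^D [∂ᵤN(e,D−e)κ(e/D)/D − N(e,D−e)(κ′(e/D)(e/D) + κ(e/D))/D²] de| ≤ (6B₁ + 5/2)(2κ₀ + κ₁)/Λ` — from the uniform gradient bound and `|N| ≤ S·D` on the line.
[cite: FeldmanSalmhoferTrubowitz1998, §3] -/
theorem trueKernel_antidiagonal_flatness_short_le {β Λ : ℝ} (hβ : 0 < β) (hΛ : 0 < Λ) {B₁ : ℝ} (hB₁ : ∀ x, |deriv salmhoferCutoff x| ≤ B₁)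
    {κ κ' : ℝ → ℝ} {κ₀ κ₁ D : ℝ} (hκb : ∀ t ∈ Icc 0 1, |κ t| ≤ κ₀) (hκ'b : ∀ t ∈ Icc 0 1, |κ' t| ≤ κ₁) (hD : 0 < D) :
    |∫ e in (0 : ℝ)..D, (ppTrueNumeratorDu β Λ e (D - e) * κ (e / D) / D -
        ppTrueNumerator β Λ e (D - e) * (κ' (e / D) * (e / D) + κ (e / D)) / D ^ 2)| ≤ (6 * B₁ + 5 / 2) * (2 * κ₀ + κ₁) / Λ := by
  have hB0 := salmhoferB₁_nonneg hB₁
  set S : ℝ := (6 * B₁ + 5 / 2) / Λ with hS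
  have hS0 : 0 ≤ S := by positivity
  have hκ₀ : 0 ≤ κ₀ := (abs_nonneg _).trans (hκb 0 (left_mem_Icc.2 zero_le_one))
  have hκ₁ : 0 ≤ κ₁ := (abs_nonneg _).trans (hκ'b 0 (left_mem_Icc.2 zero_le_one))
  have hpt : ∀ e ∈ Ι (0 : ℝ) D, ‖ppTrueNumeratorDu β Λ e (D - e) * κ (e / D) / D -
      ppTrueNumerator β Λ e (D - e) * (κ' (e / D) * (e / D) + κ (e / D)) / D ^ 2‖ ≤ S * (2 * κ₀ + κ₁) / D := fun e he => by
    rw [uIoc_of_le hD.le] at he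
    have ht : e / D ∈ Icc (0 : ℝ) 1 := ⟨div_nonneg he.1.le hD.le, (div_le_one hD).2 he.2⟩
    have hN := abs_ppTrueNumerator_le_sum hβ hΛ hB₁ he.1.le (by linarith [he.2] : 0 ≤ D - e)
    rw [add_sub_cancel] at hN
    have hDu := abs_ppTrueNumeratorDu_le_unif hβ hΛ hB₁ e (D - e)
    have hk := hκb _ ht
    have hk' := hκ'b _ ht
    rw [Real.norm_eq_abs]
    refine (abs_sub _ _).trans ?_
    rw [abs_div, abs_div, abs_mul, abs_mul, abs_of_pos hD, abs_of_pos (pow_pos hD 2)]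
    have hA : |ppTrueNumeratorDu β Λ e (D - e)| * |κ (e / D)| / D ≤ S * κ₀ / D :=
      div_le_div_of_nonneg_right (mul_le_mul hDu hk (abs_nonneg _) hS0) hD.le
    have hB : |ppTrueNumerator β Λ e (D - e)| * |κ' (e / D) * (e / D) + κ (e / D)| / D ^ 2 ≤ S * D * (κ₁ + κ₀) / D ^ 2 := by
      refine div_le_div_of_nonneg_right (mul_le_mul hN ?_ (abs_nonneg _) (by positivity)) (pow_pos hD 2).le
      refine (abs_add_le _ _).trans (add_le_add ?_ hk)
      rw [abs_mul, abs_of_nonneg ht.1]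
      calc |κ' (e / D)| * (e / D) ≤ κ₁ * 1 := mul_le_mul hk' ht.2 ht.1 hκ₁
        _ = κ₁ := mul_one _
    calc |ppTrueNumeratorDu β Λ e (D - e)| * |κ (e / D)| / D + |ppTrueNumerator β Λ e (D - e)| * |κ' (e / D) * (e / D) + κ (e / D)| / D ^ 2
        ≤ S * κ₀ / D + S * D * (κ₁ + κ₀) / D ^ 2 := add_le_add hA hB
      _ = S * (2 * κ₀ + κ₁) / D := by field_simp; ring
  have h := intervalIntegral.norm_integral_le_of_norm_le_const hpt
  rw [Real.norm_eq_abs, sub_zero, abs_of_pos hD] at h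
  refine h.trans (le_of_eq ?_)
  rw [hS]
  field_simp

/-! ## §4 The (N2) shape for every line -/

/-- **THE FLATNESS NUMBER OF THE TRUE KERNEL IN (N2)'s SHAPE, FOR EVERY `D > 0`.**  `0 < β`, `0 < Λ`, `|χ′| ≤ B₁`; split `κ ∈ C¹`, `|κ| ≤ κ₀`, `|κ′| ≤ κ₁` on `[0,1]`,
`κ = 0` on `[t₁, ∞)`, `0 ≤ t₁ < 1`.  THEN for every `D > 0`:
`|∫_0^D ∂ᵤK(e,D−e) de| ≤ A₁·Λ/max(D,Λ)²`,  `A₁ = (6B₁+5/2)(2κ₀+κ₁)·4/(1−t₁)² + κ₀(10B₁ + 7/2 + 2/(βΛ) + 1/(1−t₁))`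
— exactly the per-line hypothesis `A₁·lo/(max (D v) lo)²` of `…C4aPreCausticAngleLayer.intervalIntegral_pre_caustic_angle_le` with `lo = Λ`.
[cite: FeldmanSalmhoferTrubowitz1998, §3] -/
theorem trueKernel_antidiagonal_flatness_shape {β Λ : ℝ} (hβ : 0 < β) (hΛ : 0 < Λ) {B₁ : ℝ} (hB₁ : ∀ x, |deriv salmhoferCutoff x| ≤ B₁)
    {κ κ' : ℝ → ℝ} {κ₀ κ₁ t₁ : ℝ} (hκ : ∀ t, HasDerivAt κ (κ' t) t) (hκ'c : Continuous κ') (hκb : ∀ t ∈ Icc 0 1, |κ t| ≤ κ₀)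
    (hκ'b : ∀ t ∈ Icc 0 1, |κ' t| ≤ κ₁) (ht₀ : 0 ≤ t₁) (ht₁ : t₁ < 1) (hκs : ∀ t, t₁ ≤ t → κ t = 0) {D : ℝ} (hD : 0 < D) :
    |∫ e in (0 : ℝ)..D, (ppTrueNumeratorDu β Λ e (D - e) * κ (e / D) / D -
        ppTrueNumerator β Λ e (D - e) * (κ' (e / D) * (e / D) + κ (e / D)) / D ^ 2)| ≤
      ((6 * B₁ + 5 / 2) * (2 * κ₀ + κ₁) * (4 / (1 - t₁) ^ 2) + κ₀ * (10 * B₁ + 7 / 2 + 2 / (β * Λ) + 1 / (1 - t₁))) *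
        (Λ / max D Λ ^ 2) := by
  have hB0 := salmhoferB₁_nonneg hB₁
  have hκ₀ : 0 ≤ κ₀ := (abs_nonneg _).trans (hκb 0 (left_mem_Icc.2 zero_le_one))
  have hκ₁ : 0 ≤ κ₁ := (abs_nonneg _).trans (hκ'b 0 (left_mem_Icc.2 zero_le_one))
  have h1t : 0 < 1 - t₁ := by linarith
  have hmax : 0 < max D Λ := lt_max_of_lt_right hΛ
  have hΛle : Λ ≤ max D Λ := le_max_right _ _
  set C₁ : ℝ := (6 * B₁ + 5 / 2) * (2 * κ₀ + κ₁) with hC₁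
  set C₂ : ℝ := κ₀ * (10 * B₁ + 7 / 2 + 2 / (β * Λ) + 1 / (1 - t₁)) with hC₂
  have hC₁0 : 0 ≤ C₁ := by positivity
  have hC₂0 : 0 ≤ C₂ := by positivity
  rcases le_or_gt D (2 * Λ / (1 - t₁)) with hshort | hlong
  · -- short line: `max(D,Λ) ≤ 2Λ/(1−t₁)`
    have hs := trueKernel_antidiagonal_flatness_short_le hβ hΛ hB₁ (κ := κ) (κ' := κ') hκb hκ'b hD
    have hm : max D Λ ≤ 2 * Λ / (1 - t₁) := by
      refine max_le hshort ?_
      rw [le_div_iff₀ h1t]; nlinarith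
    -- `C₁/Λ ≤ C₁·(4/(1−t₁)²)·Λ/max²`
    have hkey : C₁ / Λ ≤ C₁ * (4 / (1 - t₁) ^ 2) * (Λ / max D Λ ^ 2) := by
      have hm2 : max D Λ ^ 2 ≤ (2 * Λ / (1 - t₁)) ^ 2 := pow_le_pow_left₀ hmax.le hm 2
      have h1 : 1 / Λ ≤ 4 / (1 - t₁) ^ 2 * (Λ / max D Λ ^ 2) := by
        rw [div_mul_div_comm, div_le_div_iff₀ hΛ (by positivity)]
        have : (1 - t₁) ^ 2 * max D Λ ^ 2 ≤ 4 * Λ ^ 2 := by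
          calc (1 - t₁) ^ 2 * max D Λ ^ 2 ≤ (1 - t₁) ^ 2 * (2 * Λ / (1 - t₁)) ^ 2 := mul_le_mul_of_nonneg_left hm2 (by positivity)
            _ = 4 * Λ ^ 2 := by field_simp; ring
        nlinarith
      calc C₁ / Λ = C₁ * (1 / Λ) := by ring
        _ ≤ C₁ * (4 / (1 - t₁) ^ 2 * (Λ / max D Λ ^ 2)) := mul_le_mul_of_nonneg_left h1 hC₁0
        _ = C₁ * (4 / (1 - t₁) ^ 2) * (Λ / max D Λ ^ 2) := by ring
    have hs' : |∫ e in (0 : ℝ)..D, (ppTrueNumeratorDu β Λ e (D - e) * κ (e / D) / D -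
        ppTrueNumerator β Λ e (D - e) * (κ' (e / D) * (e / D) + κ (e / D)) / D ^ 2)| ≤ C₁ / Λ := by
      rw [hC₁]; exact hs
    refine hs'.trans (hkey.trans ?_)
    have : 0 ≤ C₂ * (Λ / max D Λ ^ 2) := by positivity
    nlinarith
  · -- long line: `Λ < (1 − t₁)D`, `max(D,Λ) = D`
    have hfar : Λ < (1 - t₁) * D := by
      rw [div_lt_iff₀ h1t] at hlong; nlinarith
    have hΛD : Λ < D := hfar.trans_le (by nlinarith)
    have hmD : max D Λ = D := max_eq_left hΛD.le
    have hl := trueKernel_antidiagonal_flatness_le hβ hΛ hB₁ hκ hκ'c hκb hκ₀ ht₀ ht₁ hκs hfar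
    rw [hmD]
    have hkey : κ₀ * ((10 * B₁ + 7 / 2) * Λ + 2 / β + Λ / (1 - t₁)) / D ^ 2 = C₂ * (Λ / D ^ 2) := by
      rw [hC₂]; field_simp
    rw [hkey] at hl
    refine hl.trans ?_
    have : 0 ≤ C₁ * (4 / (1 - t₁) ^ 2) * (Λ / D ^ 2) := by positivity
    nlinarith

end Summit.HubbardSuperconductivity.HubbardSuperconductivity.Theorems.C4a

end
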